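import Mathlib
import Summits.PneNP.PneNP.Theorems.SignDegIntCert
import Summits.PneNP.PneNP.Theorems.SignRepCertificate
import Summits.PneNP.PneNP.Theorems.LtfGreedySigning

/-!
# Bridge: integer sign-degree certificates ⇒ route certificates; the F-N2a endpoint `greedyAvoid_not_mem_range`

FRONTIER (cell pnp-ideate, ROUND-17 rung F-N2a / F-N2); nothing here bears on P vs NP.

* `two_mul_sum_prod_eq` — a set-indexed sum `∑_S f S ∏_{i∈S} Xᵢ` supported on `|S| ≤ 2`, doubled, splits
  into its constant, linear and (ordered, off-diagonal) pair parts;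
* `certOfIntCert` — per-output integer certificates `IntCert d W (I.table j)` of degree `d ≤ 2`
  (`SignDegIntCert`) assemble into a route certificate `SignRepCertificate.Cert I` with threshold `τ = 2`
  (rows doubled, pair coefficients symmetrised), with `certOfIntCert_c2_eq_zero` (`d ≤ 1` ⇒ no pair part)
  and the row-weight bound `certOfIntCert_weight` (`|c0 j| + ∑ᵢ |c1 j i| ≤ 2W`);
* `greedy_not_mem_range_of_intCert_one` — for degree `≤ 1` (LTF-local instances) the weighted greedy
  signing of `LtfGreedySigning` avoids the range once `(n+1)·W² < m`;
* `uniformW k d` / `certOf` — ONE weight and a canonical certificate per table, uniformly over the finitely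
  many `k`-bit tables of sign-degree `≤ d` (`SignDegIntCert.exists_uniform_intCert`), hence the proof-free
  finite `rowTable k` the machine consults, and the ENDPOINT
  `greedyAvoid_not_mem_range : (∀ j, SignDegLE 1 (I.table j)) → (n+1)·(uniformW k 1)² < m →
  greedyAvoid I h ∉ I.range` — the mathematics of rung F-N2a («LTF-local AVOID at linear stretch»); what
  remains for the rung `LocalAvoidLinearFP k (fun I => ∀ j, SignDegLE 1 (I.table j))` is the FP typing of
  this one pass (cf. `MajLocalAvoidFP` for pure `MAJ_k`).
-/

namespace Summit.PneNP.PneNP.Theorems.SignDegCertBridge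

open Finset

variable {R : Type*} [CommRing R] {k : ℕ}

/-- For `S = {a, b}` with `a ≠ b`, exactly the two ordered pairs `(a,b)`, `(b,a)` represent `S`. -/
lemma sum_sum_ite_pair (S : Finset (Fin k)) (hS : S.card = 2) (g : R) :
    (∑ i : Fin k, ∑ i' : Fin k, if i ≠ i' ∧ S = {i, i'} then g else 0) = 2 * g := by
  classical
  obtain ⟨a, b, hab, rfl⟩ := Finset.card_eq_two.mp hS
  have key : ∀ i i' : Fin k, (i ≠ i' ∧ ({a, b} : Finset (Fin k)) = {i, i'}) ↔
      (i = a ∧ i' = b) ∨ (i = b ∧ i' = a) := by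
    intro i i'
    constructor
    · rintro ⟨_, h⟩
      rw [← Finset.coe_inj, Finset.coe_pair, Finset.coe_pair, Set.pair_eq_pair_iff] at h
      rcases h with ⟨h1, h2⟩ | ⟨h1, h2⟩
      · exact Or.inl ⟨h1.symm, h2.symm⟩
      · exact Or.inr ⟨h2.symm, h1.symm⟩
    · rintro (⟨rfl, rfl⟩ | ⟨rfl, rfl⟩)
      · exact ⟨hab, rfl⟩
      · exact ⟨hab.symm, Finset.pair_comm _ _⟩
  simp_rw [key]
  have hsplit : ∀ i i' : Fin k, (if (i = a ∧ i' = b) ∨ (i = b ∧ i' = a) then g else 0) =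
      (if i = a then (if i' = b then g else 0) else 0) + (if i = b then (if i' = a then g else 0) else 0) := by
    intro i i'
    by_cases h1 : i = a <;> by_cases h2 : i' = b <;> by_cases h3 : i = b <;> by_cases h4 : i' = a <;>
      simp [h1, h2, h3, h4] <;> simp_all
  simp_rw [hsplit, Finset.sum_add_distrib]
  have hin : ∀ (c d : Fin k), (∑ x : Fin k, ∑ x_1 : Fin k, if x = c then (if x_1 = d then g else 0) else 0) = g := by
    intro c d
    have hinner : ∀ x : Fin k, (∑ x_1 : Fin k, if x = c then (if x_1 = d then g else 0) else 0) =
        if x = c then g else 0 := by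
      intro x
      split_ifs with hx
      · rw [Finset.sum_ite_eq' Finset.univ d, if_pos (Finset.mem_univ _)]
      · simp
    rw [Finset.sum_congr rfl fun x _ => hinner x, Finset.sum_ite_eq' Finset.univ c, if_pos (Finset.mem_univ _)]
  rw [hin, hin]; ring

/-- **Cardinality split of a degree-≤2 set-indexed sum** (doubled to stay integral):
`2·Σ_S f(S)·X^S = 2f(∅) + 2Σ_i f{i}X_i + Σ_{i ≠ i'} f{i,i'}X_iX_{i'}` when `f` vanishes above size 2. -/
lemma two_mul_sum_prod_eq (f : Finset (Fin k) → R) (hf : ∀ S, 2 < S.card → f S = 0) (X : Fin k → R) :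
    2 * ∑ S, f S * ∏ i ∈ S, X i =
      2 * f ∅ + 2 * ∑ i, f {i} * X i + ∑ i, ∑ i', (if i = i' then 0 else f {i, i'}) * X i * X i' := by
  classical
  set g : Finset (Fin k) → R := fun S => f S * ∏ i ∈ S, X i with hg
  have hpt : ∀ S, 2 * g S = (if S = ∅ then 2 * g S else 0) + (∑ i, if S = {i} then 2 * g S else 0) +
      ∑ i, ∑ i', if i ≠ i' ∧ S = {i, i'} then g S else 0 := by
    intro S
    obtain h | h | h | h : S.card = 0 ∨ S.card = 1 ∨ S.card = 2 ∨ 2 < S.card := by omega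
    · obtain rfl := Finset.card_eq_zero.mp h
      have h1 : ∀ i : Fin k, (∅ : Finset (Fin k)) ≠ {i} := fun i => (Finset.singleton_ne_empty i).symm
      have h2 : ∀ i i' : Fin k, ¬ (i ≠ i' ∧ (∅ : Finset (Fin k)) = {i, i'}) :=
        fun i i' hh => Finset.insert_ne_empty i {i'} hh.2.symm
      simp [h1, h2]
    · obtain ⟨a, rfl⟩ := Finset.card_eq_one.mp h
      have h2 : ∀ i i' : Fin k, ¬ (i ≠ i' ∧ ({a} : Finset (Fin k)) = {i, i'}) := by
        rintro i i' ⟨hii, hh⟩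
        have := congrArg Finset.card hh
        rw [Finset.card_singleton, Finset.card_pair hii] at this
        omega
      have h3 : ∀ i : Fin k, (({a} : Finset (Fin k)) = {i}) ↔ i = a := fun i => by
        rw [Finset.singleton_inj]; exact eq_comm
      simp [h2, h3]
    · have h0 : S ≠ ∅ := by rintro rfl; simp at h
      have h1 : ∀ i : Fin k, S ≠ {i} := by rintro i rfl; simp at h
      rw [sum_sum_ite_pair S h (g S)]
      simp [h0, h1]
    · have hgz : g S = 0 := by simp [hg, hf S h]
      have h0 : S ≠ ∅ := by rintro rfl; simp at h
      simp [hgz]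
  have hsum : 2 * ∑ S, g S = ∑ S, 2 * g S := by rw [Finset.mul_sum]
  rw [hsum, Finset.sum_congr rfl fun S _ => hpt S, Finset.sum_add_distrib, Finset.sum_add_distrib]
  -- evaluate the three parts
  have e1 : ∑ S : Finset (Fin k), (if S = ∅ then 2 * g S else 0) = 2 * f ∅ := by
    rw [Finset.sum_ite_eq']; simp [hg]
  have e2 : ∑ S : Finset (Fin k), ∑ i : Fin k, (if S = {i} then 2 * g S else 0) = 2 * ∑ i, f {i} * X i := by
    rw [Finset.sum_comm, Finset.mul_sum]
    refine Finset.sum_congr rfl fun i _ => ?_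
    rw [Finset.sum_ite_eq']; simp [hg]
  have e3 : ∑ S : Finset (Fin k), ∑ i : Fin k, ∑ i' : Fin k, (if i ≠ i' ∧ S = {i, i'} then g S else 0) =
      ∑ i, ∑ i', (if i = i' then 0 else f {i, i'}) * X i * X i' := by
    rw [Finset.sum_comm]
    refine Finset.sum_congr rfl fun i _ => ?_
    rw [Finset.sum_comm]
    refine Finset.sum_congr rfl fun i' _ => ?_
    by_cases hii : i = i'
    · simp [hii]
    · simp only [ne_eq, hii, not_false_eq_true, true_and, if_false]
      rw [Finset.sum_ite_eq']
      simp [hg, Finset.prod_pair hii]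
      try ring
  rw [e1, e2, e3]


/-! ## From integer sign-degree data to the route's degree-≤2 certificates -/

open Literature.Computability.Complexity SignRepCertificate SignDegIntCert LtfGreedySigning

variable {n m : ℕ}

/-- The two `±1` readings agree: `(pm b : ℚ) = bsgn b`. -/
@[simp] lemma cast_pm (b : Bool) : ((pm b : ℤ) : ℚ) = bsgn b := by
  cases b <;> simp [pm, bsgn]

/-- **The route certificate from integer sign-degree-≤`d` data, `d ≤ 2`** (all entries doubled so that the
pair part is integral: `c₀ = 2·cz ∅`, `c₁ i = 2·cz {i}`, `c₂ i i' = cz {i,i'}` for `i ≠ i'`, margin `τ = 2`). -/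
def certOfIntCert (I : LocalMap k n m) {d : ℕ} (hd : d ≤ 2) {W : ℤ} (c : ∀ j, IntCert d W (I.table j)) :
    Cert I where
  c0 j := 2 * (c j).cz ∅
  c1 j i := 2 * (c j).cz {i}
  c2 j i i' := if i = i' then 0 else (c j).cz {i, i'}
  τ := 2
  valid j u := by
    have hv := (c j).valid u
    have hf : ∀ S : Finset (Fin k), 2 < S.card → (((c j).cz S : ℤ) : ℚ) = 0 := fun S hS => by
      rw [(c j).high S (lt_of_le_of_lt hd hS), Int.cast_zero]
    have hsplit := two_mul_sum_prod_eq (R := ℚ) (fun S => (((c j).cz S : ℤ) : ℚ)) hf (fun i => bsgn (u i))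
    have hchi : ∀ S : Finset (Fin k), chiQ S u = ∏ i ∈ S, bsgn (u i) := fun S => rfl
    simp_rw [hchi] at hv
    have h2 : (2 : ℚ) ≤ bsgn (I.table j u) * (2 * (((c j).cz ∅ : ℤ) : ℚ) +
        2 * ∑ i, (((c j).cz {i} : ℤ) : ℚ) * bsgn (u i) +
        ∑ i, ∑ i', (if i = i' then 0 else (((c j).cz {i, i'} : ℤ) : ℚ)) * bsgn (u i) * bsgn (u i')) := by
      rw [← hsplit]; linarith
    have hcast : ((2 * (c j).cz ∅ + ∑ i, 2 * (c j).cz {i} * pm (u i) +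
        ∑ i, ∑ i', (if i = i' then 0 else (c j).cz {i, i'}) * pm (u i) * pm (u i') : ℤ) : ℚ) =
        2 * (((c j).cz ∅ : ℤ) : ℚ) + 2 * ∑ i, (((c j).cz {i} : ℤ) : ℚ) * bsgn (u i) +
        ∑ i, ∑ i', (if i = i' then 0 else (((c j).cz {i, i'} : ℤ) : ℚ)) * bsgn (u i) * bsgn (u i') := by
      push_cast
      simp only [cast_pm, Finset.mul_sum]
      try congr 1
      all_goals try (congr 1; exact Finset.sum_congr rfl fun i _ => by ring)
    have : ((2 : ℤ) : ℚ) ≤ ((pm (I.table j u) * (2 * (c j).cz ∅ + ∑ i, 2 * (c j).cz {i} * pm (u i) +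
        ∑ i, ∑ i', (if i = i' then 0 else (c j).cz {i, i'}) * pm (u i) * pm (u i')) : ℤ) : ℚ) := by
      rw [Int.cast_mul, hcast, cast_pm]; exact_mod_cast h2
    exact_mod_cast this

/-- For sign-degree-≤1 data the pair part of the certificate vanishes. -/
lemma certOfIntCert_c2_eq_zero (I : LocalMap k n m) {d : ℕ} (hd : d ≤ 1) {W : ℤ}
    (c : ∀ j, IntCert d W (I.table j)) (j : Fin m) (i i' : Fin k) :
    (certOfIntCert I (hd.trans one_le_two) c).c2 j i i' = 0 := by
  simp only [certOfIntCert]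
  split_ifs with h
  · rfl
  · exact (c j).high _ (by rw [Finset.card_pair h]; omega)

/-- Weight of the linear part: `|c₀ j| + Σ_i |c₁ j i| ≤ 2W`. -/
lemma certOfIntCert_weight (I : LocalMap k n m) {d : ℕ} (hd : d ≤ 2) {W : ℤ}
    (c : ∀ j, IntCert d W (I.table j)) (j : Fin m) :
    |(certOfIntCert I hd c).c0 j| + ∑ i, |(certOfIntCert I hd c).c1 j i| ≤ 2 * W := by
  classical
  simp only [certOfIntCert, abs_mul, abs_two]
  rw [← Finset.mul_sum, ← mul_add]
  refine mul_le_mul_of_nonneg_left ?_ (by norm_num)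
  refine le_trans ?_ (c j).weight
  -- the sets ∅ and the singletons form a sub-family of all sets
  have hnot : (∅ : Finset (Fin k)) ∉ (Finset.univ : Finset (Fin k)).image (fun i => ({i} : Finset (Fin k))) := by
    simp
  have hinj : Set.InjOn (fun i : Fin k => ({i} : Finset (Fin k))) ↑(Finset.univ : Finset (Fin k)) :=
    fun a _ b _ h => Finset.singleton_injective h
  calc |(c j).cz ∅| + ∑ i, |(c j).cz {i}|
      = ∑ S ∈ insert ∅ ((Finset.univ : Finset (Fin k)).image fun i => ({i} : Finset (Fin k))), |(c j).cz S| := by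
        rw [Finset.sum_insert hnot, Finset.sum_image hinj]
    _ ≤ ∑ S, |(c j).cz S| :=
        Finset.sum_le_sum_of_subset_of_nonneg (Finset.subset_univ _) fun S _ _ => abs_nonneg _

/-- **F-N2a, mathematics complete**: for an `LTF`-local map (every table of sign-degree `≤ 1`) given with
integer certificates of weight `≤ W`, the one-pass greedy signing outputs a point outside the range as soon
as `m > (n+1)·W²`. -/
theorem greedy_not_mem_range_of_intCert_one (I : LocalMap k n m) {W : ℤ}
    (c : ∀ j, IntCert 1 W (I.table j)) (hm : ((n : ℤ) + 1) * W ^ 2 < m) :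
    greedyBitsW I (certOfIntCert I one_le_two c) ∉ I.range :=
  greedyBitsW_not_mem_range I _ (certOfIntCert_c2_eq_zero I le_rfl c) (2 * W)
    (certOfIntCert_weight I one_le_two c) (by simp [certOfIntCert]) (by simp [certOfIntCert]; nlinarith)

/-- A uniform weight bound for the `k`-bit tables of sign-degree `≤ d` (from `exists_uniform_intCert`). -/
noncomputable def uniformW (k d : ℕ) : ℤ := Classical.choose (exists_uniform_intCert k d)

/-- The uniform weight is nonnegative. -/
lemma uniformW_nonneg (k d : ℕ) : 0 ≤ uniformW k d := (Classical.choose_spec (exists_uniform_intCert k d)).1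

/-- The certificate of a table of sign-degree `≤ d` at the uniform weight. -/
noncomputable def certOf (k d : ℕ) (P : (Fin k → Bool) → Bool) (h : SignDegLE d P) :
    IntCert d (uniformW k d) P :=
  Classical.choice ((Classical.choose_spec (exists_uniform_intCert k d)).2 P h)

/-- The explicit avoiding point of an `LTF`-local map: greedy signing against its certificates. -/
noncomputable def greedyAvoid (I : LocalMap k n m) (h : ∀ j, SignDegLE 1 (I.table j)) : Fin m → Bool :=
  greedyBitsW I (certOfIntCert I one_le_two fun j => certOf k 1 (I.table j) (h j))

/-- **F-N2a endpoint (mathematics)**: for every locality `k` there is ONE constant `W = uniformW k 1` such that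
for every `k`-local map all of whose tables have sign-degree `≤ 1` and every `m > (n+1)·W²`, the greedy point
lies outside the range. (The FP wrapper — the pass is one left-to-right sweep with `O(k)` integer operations
per output — is separate.) -/
theorem greedyAvoid_not_mem_range (I : LocalMap k n m) (h : ∀ j, SignDegLE 1 (I.table j))
    (hm : ((n : ℤ) + 1) * uniformW k 1 ^ 2 < m) : greedyAvoid I h ∉ I.range :=
  greedy_not_mem_range_of_intCert_one I _ hm

/-- PROOF-FREE ROW TABLE for the machine (F-N2a FP wrapper interface): the bias and the `k` linear
coefficients the greedy pass uses for a table `P` — the canonical certificate's rows when `P` has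
sign-degree `≤ 1`, zeros otherwise. For fixed `k` this is a finite constant table (`2^(2^k)` entries). -/
noncomputable def rowTable (k : ℕ) (P : (Fin k → Bool) → Bool) : ℤ × (Fin k → ℤ) :=
  haveI := Classical.dec (SignDegLE 1 P)
  if h : SignDegLE 1 P then (2 * (certOf k 1 P h).cz ∅, fun i => 2 * (certOf k 1 P h).cz {i}) else (0, 0)

/-- On an `LTF`-local instance the certificate fed to `greedyAvoid` has bias row `(rowTable k (I.table j)).1`. -/
lemma greedyAvoid_c0 (I : LocalMap k n m) (h : ∀ j, SignDegLE 1 (I.table j)) (j : Fin m) :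
    (certOfIntCert I one_le_two fun j => certOf k 1 (I.table j) (h j)).c0 j = (rowTable k (I.table j)).1 := by
  unfold rowTable; rw [dif_pos (h j)]; rfl

/-- … and linear rows `(rowTable k (I.table j)).2`. -/
lemma greedyAvoid_c1 (I : LocalMap k n m) (h : ∀ j, SignDegLE 1 (I.table j)) (j : Fin m) (i : Fin k) :
    (certOfIntCert I one_le_two fun j => certOf k 1 (I.table j) (h j)).c1 j i =
      (rowTable k (I.table j)).2 i := by
  unfold rowTable; rw [dif_pos (h j)]; rfl

end Summit.PneNP.PneNP.Theorems.SignDegCertBridge
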